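import Mathlib
import Summits.ValiantsHypothesis.ValiantsHypothesis.Theorems.RigidityForcesSymmetryRankRigidMinimalReprLaplaceFiveTriangleDigon
import Summits.ValiantsHypothesis.ValiantsHypothesis.Theorems.RigidityForcesSymmetryRankRigidMinimalReprLaplaceFiveCycle

/-!
# `LaplaceOptimalFive`, pair-only profiles: transport of five-pair decompositions and the two canonical kills
# (crux `RankRigidMinimalRepr`, stmt-ValiantsHypothesis-18034; frontier rung `LaplaceOptimalFive`, stmt-24813)

Bookkeeping for the rung `72 ≤ weight` of the frontier item `LaplaceOptimal 5` (stmt-24813).  A FIVE-PAIR decomposition of the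
`5 × 5` permutation pattern in local form — pair terms `u_t(v) · w_t(v)`, `u_t` a function of `(v_{p t}, v_{q t})`, `w_t` blind
to the slots `p t, q t` — is transported along a slot relabelling `σ` (with inverse `τ`) and a term re-indexing `κ` (with inverse
`κ'`), the new cuts being any orientation of `σ({p (κ t), q (κ t)})` (`pairs_transport`; plain functions with two-sided inverses,
so that the matching hypotheses of a concrete transport are decidable).  The two canonical labellings are then killed by the
explicit theorems of this seat: the `5`-cycle `(p, q) = ((0,1,2,3,4), (1,2,3,4,0))` by `LaplaceFivePairCore.five_cycle`
(`five_cycle_pq`) and the triangle-plus-digon `(p, q) = ((0,0,1,3,3), (1,2,2,4,4))` by `LaplaceFivePairCore.triangle_digon`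
(`triangle_digon_pq`).

HONEST FRAMING: infrastructure toward the rung `72 ≤ weight` of `LaplaceOptimalFive` (stmt-24813), which stays OPEN; nothing
here bears on the crux or on `VP ≠ VNP`, which is NOT proved.
-/

set_option autoImplicit false

-- the mandated summit-side namespace repeats a component by design (single-problem summit)
set_option linter.dupNamespace false

namespace Summit.ValiantsHypothesis.ValiantsHypothesis.Theorems.RigidityForcesSymmetryRankRigidMinimalRepr

namespace LaplaceFivePairCore

open Finset

/-! ### §1 Transport of a five-pair decomposition -/

/-- **Transport.**  A five-pair decomposition with cuts `(p t, q t)` yields, for a slot relabelling `σ` (two-sided inverse `τ`), a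
term re-indexing `κ` (two-sided inverse `κ'`) and target cuts `(P t, Q t)` matching `σ({p (κ t), q (κ t)})` in either orientation,
a five-pair decomposition with cuts `(P t, Q t)`: `u''_t(v) = u_{κ t}(v ∘ σ)`, `w''_t(v) = w_{κ t}(v ∘ σ)`. -/
theorem pairs_transport (p q : Fin 5 → Fin 5) (u w : Fin 5 → (Fin 5 → Fin 5) → ℂ)
    (hu : ∀ t, ∀ v v' : Fin 5 → Fin 5, v (p t) = v' (p t) → v (q t) = v' (q t) → u t v = u t v')
    (hw : ∀ t, ∀ v v' : Fin 5 → Fin 5, (∀ j, j ≠ p t → j ≠ q t → v j = v' j) → w t v = w t v')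
    (hsum : ∀ v : Fin 5 → Fin 5, (if Function.Injective v then (1 : ℂ) else 0) = ∑ t, u t v * w t v)
    (σ τ κ κ' : Fin 5 → Fin 5) (hτσ : ∀ x, τ (σ x) = x) (hστ : ∀ x, σ (τ x) = x)
    (hκ'κ : ∀ t, κ' (κ t) = t) (hκκ' : ∀ t, κ (κ' t) = t) (P Q : Fin 5 → Fin 5)
    (hPQ : ∀ t, (σ (p (κ t)) = P t ∧ σ (q (κ t)) = Q t) ∨ (σ (p (κ t)) = Q t ∧ σ (q (κ t)) = P t)) :
    ∃ u'' w'' : Fin 5 → (Fin 5 → Fin 5) → ℂ,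
      (∀ t, ∀ v v' : Fin 5 → Fin 5, v (P t) = v' (P t) → v (Q t) = v' (Q t) → u'' t v = u'' t v') ∧
      (∀ t, ∀ v v' : Fin 5 → Fin 5, (∀ j, j ≠ P t → j ≠ Q t → v j = v' j) → w'' t v = w'' t v') ∧
      ∀ v : Fin 5 → Fin 5, (if Function.Injective v then (1 : ℂ) else 0) = ∑ t, u'' t v * w'' t v := by
  let eσ : Equiv.Perm (Fin 5) := ⟨σ, τ, hτσ, hστ⟩
  let eκ : Equiv.Perm (Fin 5) := ⟨κ, κ', hκ'κ, hκκ'⟩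
  refine ⟨fun t v => u (κ t) (v ∘ σ), fun t v => w (κ t) (v ∘ σ), ?_, ?_, ?_⟩
  · intro t v v' h1 h2
    refine hu (κ t) _ _ ?_ ?_
    · rcases hPQ t with ⟨e1, -⟩ | ⟨e1, -⟩ <;> simp only [Function.comp_apply, e1, h1, h2]
    · rcases hPQ t with ⟨-, e2⟩ | ⟨-, e2⟩ <;> simp only [Function.comp_apply, e2, h1, h2]
  · intro t v v' hvv'
    refine hw (κ t) _ _ (fun j hjp hjq => ?_)
    simp only [Function.comp_apply]
    refine hvv' (σ j) ?_ ?_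
    · intro h
      rcases hPQ t with ⟨e1, e2⟩ | ⟨e1, e2⟩
      · exact hjp (by rw [← hτσ j, h, ← e1, hτσ])
      · exact hjq (by rw [← hτσ j, h, ← e2, hτσ])
    · intro h
      rcases hPQ t with ⟨e1, e2⟩ | ⟨e1, e2⟩
      · exact hjq (by rw [← hτσ j, h, ← e2, hτσ])
      · exact hjp (by rw [← hτσ j, h, ← e1, hτσ])
  · intro v
    have H := hsum (v ∘ σ)
    have hinj : Function.Injective (v ∘ σ) ↔ Function.Injective v := eσ.injective_comp v
    rw [if_congr hinj rfl rfl] at H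
    rw [H]
    exact (Equiv.sum_comp eκ (fun t => u t (v ∘ σ) * w t (v ∘ σ))).symm

/-! ### §2 The two canonical labellings -/

/-- **The `5`-cycle in local pair format** (`p = (0,1,2,3,4)`, `q = (1,2,3,4,0)`) does not decompose `P₅`. -/
theorem five_cycle_pq (u w : Fin 5 → (Fin 5 → Fin 5) → ℂ)
    (hu : ∀ t, ∀ v v' : Fin 5 → Fin 5, v ((![0, 1, 2, 3, 4] : Fin 5 → Fin 5) t) = v' ((![0, 1, 2, 3, 4] : Fin 5 → Fin 5) t) →
      v ((![1, 2, 3, 4, 0] : Fin 5 → Fin 5) t) = v' ((![1, 2, 3, 4, 0] : Fin 5 → Fin 5) t) → u t v = u t v')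
    (hw : ∀ t, ∀ v v' : Fin 5 → Fin 5, (∀ j, j ≠ (![0, 1, 2, 3, 4] : Fin 5 → Fin 5) t →
      j ≠ (![1, 2, 3, 4, 0] : Fin 5 → Fin 5) t → v j = v' j) → w t v = w t v') :
    ¬ ∀ v : Fin 5 → Fin 5, (if Function.Injective v then (1 : ℂ) else 0) = ∑ t, u t v * w t v := by
  intro hsum
  refine five_cycle (fun a b => u 0 ![a, b, 0, 0, 0]) (fun a b => u 1 ![0, a, b, 0, 0]) (fun a b => u 2 ![0, 0, a, b, 0])
    (fun a b => u 3 ![0, 0, 0, a, b]) (fun a b => u 4 ![b, 0, 0, 0, a])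
    (fun c d e => w 0 ![0, 0, c, d, e]) (fun c d e => w 1 ![e, 0, 0, c, d]) (fun c d e => w 2 ![d, e, 0, 0, c])
    (fun c d e => w 3 ![c, d, e, 0, 0]) (fun c d e => w 4 ![0, c, d, e, 0]) (fun v => ?_)
  rw [hsum v, Fin.sum_univ_five]
  have e0 : u 0 v = u 0 ![v 0, v 1, 0, 0, 0] := hu 0 _ _ rfl rfl
  have e1 : u 1 v = u 1 ![0, v 1, v 2, 0, 0] := hu 1 _ _ rfl rfl
  have e2 : u 2 v = u 2 ![0, 0, v 2, v 3, 0] := hu 2 _ _ rfl rfl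
  have e3 : u 3 v = u 3 ![0, 0, 0, v 3, v 4] := hu 3 _ _ rfl rfl
  have e4 : u 4 v = u 4 ![v 0, 0, 0, 0, v 4] := hu 4 _ _ rfl rfl
  have f0 : w 0 v = w 0 ![0, 0, v 2, v 3, v 4] := hw 0 _ _ (fun j h1 h2 => by
    fin_cases j <;> first | rfl | exact absurd rfl h1 | exact absurd rfl h2)
  have f1 : w 1 v = w 1 ![v 0, 0, 0, v 3, v 4] := hw 1 _ _ (fun j h1 h2 => by
    fin_cases j <;> first | rfl | exact absurd rfl h1 | exact absurd rfl h2)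
  have f2 : w 2 v = w 2 ![v 0, v 1, 0, 0, v 4] := hw 2 _ _ (fun j h1 h2 => by
    fin_cases j <;> first | rfl | exact absurd rfl h1 | exact absurd rfl h2)
  have f3 : w 3 v = w 3 ![v 0, v 1, v 2, 0, 0] := hw 3 _ _ (fun j h1 h2 => by
    fin_cases j <;> first | rfl | exact absurd rfl h1 | exact absurd rfl h2)
  have f4 : w 4 v = w 4 ![0, v 1, v 2, v 3, 0] := hw 4 _ _ (fun j h1 h2 => by
    fin_cases j <;> first | rfl | exact absurd rfl h1 | exact absurd rfl h2)
  rw [e0, e1, e2, e3, e4, f0, f1, f2, f3, f4]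

/-- **The triangle-plus-digon in local pair format** (`p = (0,0,1,3,3)`, `q = (1,2,2,4,4)`) does not decompose `P₅`. -/
theorem triangle_digon_pq (u w : Fin 5 → (Fin 5 → Fin 5) → ℂ)
    (hu : ∀ t, ∀ v v' : Fin 5 → Fin 5, v ((![0, 0, 1, 3, 3] : Fin 5 → Fin 5) t) = v' ((![0, 0, 1, 3, 3] : Fin 5 → Fin 5) t) →
      v ((![1, 2, 2, 4, 4] : Fin 5 → Fin 5) t) = v' ((![1, 2, 2, 4, 4] : Fin 5 → Fin 5) t) → u t v = u t v')
    (hw : ∀ t, ∀ v v' : Fin 5 → Fin 5, (∀ j, j ≠ (![0, 0, 1, 3, 3] : Fin 5 → Fin 5) t →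
      j ≠ (![1, 2, 2, 4, 4] : Fin 5 → Fin 5) t → v j = v' j) → w t v = w t v') :
    ¬ ∀ v : Fin 5 → Fin 5, (if Function.Injective v then (1 : ℂ) else 0) = ∑ t, u t v * w t v := by
  intro hsum
  refine triangle_digon (fun a b => u 0 ![a, b, 0, 0, 0]) (fun a b => u 1 ![a, 0, b, 0, 0]) (fun a b => u 2 ![0, a, b, 0, 0])
    (fun a b => u 3 ![0, 0, 0, a, b]) (fun a b => u 4 ![0, 0, 0, a, b])
    (fun c d e => w 0 ![0, 0, c, d, e]) (fun c d e => w 1 ![0, c, 0, d, e]) (fun c d e => w 2 ![c, 0, 0, d, e])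
    (fun c d e => w 3 ![c, d, e, 0, 0]) (fun c d e => w 4 ![c, d, e, 0, 0]) (fun v => ?_)
  rw [hsum v, Fin.sum_univ_five]
  have e0 : u 0 v = u 0 ![v 0, v 1, 0, 0, 0] := hu 0 _ _ rfl rfl
  have e1 : u 1 v = u 1 ![v 0, 0, v 2, 0, 0] := hu 1 _ _ rfl rfl
  have e2 : u 2 v = u 2 ![0, v 1, v 2, 0, 0] := hu 2 _ _ rfl rfl
  have e3 : u 3 v = u 3 ![0, 0, 0, v 3, v 4] := hu 3 _ _ rfl rfl
  have e4 : u 4 v = u 4 ![0, 0, 0, v 3, v 4] := hu 4 _ _ rfl rfl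
  have f0 : w 0 v = w 0 ![0, 0, v 2, v 3, v 4] := hw 0 _ _ (fun j h1 h2 => by
    fin_cases j <;> first | rfl | exact absurd rfl h1 | exact absurd rfl h2)
  have f1 : w 1 v = w 1 ![0, v 1, 0, v 3, v 4] := hw 1 _ _ (fun j h1 h2 => by
    fin_cases j <;> first | rfl | exact absurd rfl h1 | exact absurd rfl h2)
  have f2 : w 2 v = w 2 ![v 0, 0, 0, v 3, v 4] := hw 2 _ _ (fun j h1 h2 => by
    fin_cases j <;> first | rfl | exact absurd rfl h1 | exact absurd rfl h2)
  have f3 : w 3 v = w 3 ![v 0, v 1, v 2, 0, 0] := hw 3 _ _ (fun j h1 h2 => by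
    fin_cases j <;> first | rfl | exact absurd rfl h1 | exact absurd rfl h2)
  have f4 : w 4 v = w 4 ![v 0, v 1, v 2, 0, 0] := hw 4 _ _ (fun j h1 h2 => by
    fin_cases j <;> first | rfl | exact absurd rfl h1 | exact absurd rfl h2)
  rw [e0, e1, e2, e3, e4, f0, f1, f2, f3, f4]

end LaplaceFivePairCore

end Summit.ValiantsHypothesis.ValiantsHypothesis.Theorems.RigidityForcesSymmetryRankRigidMinimalRepr
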